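import Summits.QuantumFields.YangMills.Theorems.BalabanUVNodesN07SplitClauseOfCoarseShift
import Summits.QuantumFields.YangMills.Theorems.BalabanUVNodesN07ShearSizeTopBox
import HarnessLib

/-!
# N07 [B11] (= [15] = [Balaban1985Variational]) Sect. F, road of record R0′, WIDTH-209 row (r2), FILE 7: **THE S6 HEAD's R0′ SPLIT CLAUSE FROM THE
# SHEAR's SIZE ALONE — SHARP (sizes only at the outer end-points and UNDER them) — and AT THE RECORD's CENTRED SHEAR** (FILE 6's four-tori clause
# with `μ := μ_λ`, `hμ` and `hout` DISCHARGED; at the record `λ_j(y) := log ĝ_j(y)⁻¹` is EXACTLY the shift letter of dag-n07-w6's composed row (r1)+(r4) and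
# `s = 2σ` comes from its PER-LEVEL box letters `v_j, a_j` — the (r2)↔(r4) seam closed by name, the tower's box-membership DISPLAYED)

Cell `pub-ymgap`, width seat `pub-ymgap-dag-n07-w8` g4, WIDTH-209 N07 row (r2) of road R0′, CLAIM-7 ∕ INTENT-7 (cell bus I.35796; own lineage FILE 5 p621432 ✓ → FILE 6 p622998 ✓ →
FILE 7; g3's HANDOFF § 7 (t3) «FILE 7»).  `--kind proof --supports stmt-QuantumFields-27364 --as helper` (K1⁹ per dag-lead KEY MAP v2 ∕ GATE v1.69); count-neutral; def-free.
[15] = T. Bałaban, Commun. Math. Phys. **102** (1985) 277–309 [Balaban1985Variational]; [6] = [Balaban1985RegularSpaces] (CMP **99** (1985) 75–102); [4] =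
[Balaban1984PropagatorsII] (CMP **96** (1984) 223–250); [I.4] = [Balaban1984PropagatorsI] (CMP **95** (1984) 17–40); [3] = [Balaban1985Averaging] (CMP **98** (1985) 17–51).

THE POINT.  FILE 6 `localGaugeSplitOn_of_gauge152_coarseShift_outerDefect_adm22_T4` delivers the S6 head's clause `LocalGaugeSplitOn Y η_{K−n} t (t₁ + (t₂ + t_∂) + t₃) U` for a
coarse family `λ` and ANY fine `μ` reproducing it on the `Λ_j` (`hμ`) whose outer defect `λ_j(y_out) − Q′_jμ(y_out)` is `≤ ς_∂` (`hout`).  FILE 5's level lift `μ_λ` supplies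
`hμ` (`siteAvgIter_levLift`); and since `(Q′_jμ_λ)(y_out)` is a block MEAN of values `λ_i(z)` at the `Λ_i`-sites `z` UNDER `y_out` (`i < j`), the outer defect is `≤ s′ + s` as soon
as `‖λ_j(y_out)‖ ≤ s′` at the outer end-points and `‖μ_λ(x)‖ ≤ s` at the fine sites `x` under them (§1 `outerDefect_levLift_le_of_norm_le_under` — SHARPER than FILE 6 §1c, which
asked the size on ALL `Λ_j`-sites: for the per-cube tower of [15] (144) ∕ `Node00.cubeDomains`, whose `Ω₀ = T` ([4] (2.1)) makes `Λ₀` the whole fine torus off `□₁`, only the sharp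
form is satisfiable by a shear that is small on the cube `□̃` alone).  §2 composes: on the shift side the head's per-datum R0′ assembly (dag-n07-w4 `S6-HEAD-RECIPE.md` § UPDATE g3)
supplies ONLY `λ` and `s`.  §3, AT THE RECORD: the family is the one dag-n07-w6's composed row `N07ShearSizeTopBox.norm_mlog_iter_avOfRecord_centred_sub_le` DISPLAYS — on a
level-`j` box bond `c`, `log M^j(U₁)(c) = log V♮(c) + (λ_j(c₋) − λ_j(c₊)) + N(c)` with `λ_j(y) := log ĝ_j(y)⁻¹`, `ĝ_j := g_j(y₀)⁻¹·g_j`, `g_j := u♮↾T^{(j)}`, `y₀ := castSite lo_j`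
— and its row (r4) `dist1 ĝ_j(y) ≤ D_j·(v_j + a_j)` gives `‖λ_j(y)‖ ≤ 2·D_j·(v_j + a_j)` on the box; with PER-LEVEL letters and a uniform `D_j·(v_j + a_j) ≤ σ ≤ ½` (at the
record `D_j ≈ 2dM·L^{k−j}` and `v_j, a_j ≈ L^{j−k}·Mε₀`: the lineage's located (166♭) factor, uniform in `j`) the clause holds for every `t_∂ > 2CB₃·(4σ)` as soon as the outer
end-points of the tower's `Λ_j`-cells, its `Λ_j`-sites (`j ≥ 1`) and the fine `Λ₀`-sites UNDER outer end-points lie in the level boxes — that box-membership is the head's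
window ∕ collar geometry and stays DISPLAYED.

WHAT IS PROVED (sorry-free; no definition; axioms standard; all BY NAME).
* §1 (generic `P : Params`, values in any real normed space) `outerDefect_levLift_le_of_forall_norm_le` (a GLOBAL size `‖λ_j(y)‖ ≤ s` gives FILE 6's `hs` + `hsout`, hence the outer
  defect of the level lift `≤ s + s`); `norm_siteAvgIter_le_of_forall_under_le` (`Q′_j` is a convex combination over the block `Bʲ(y)`: `‖(Q′_jf)(y)‖ ≤ a` from `‖f‖ ≤ a` on
  `Bʲ(y)` ALONE); ★ `outerDefect_levLift_le_of_norm_le_under` (THE SHARP OUTER DEFECT: `≤ s′ + s` from `‖λ_j(y_out)‖ ≤ s′` at the outer end-points and `‖μ_λ(x)‖ ≤ s` at the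
  fine sites under them); `iterBlockOf_levOf_mem_of_lamSite` (plumbing: a per-level box family containing the `Λ_j`-sites for `j ≥ 1` and a given `Λ₀`-site `x` contains the
  `Λ_{j(x)}`-site over `x`).
* §2 (NODE 00's four-tori) ★★ `localGaugeSplitOn_of_gauge152_coarseShift_levLift_adm22_T4 F N` — FILE 6 §2 at `μ := μ_λ`: same ∃-constants `M_h⁰, R₀, C, δ₀, δ₁, B₃`; binders on
  the shift side: `λ`, `0 ≤ s`, `hs` (on the `Λ_j`-sites), `hsout` (at the outer end-points), `hX` (`X` = coarse gradient of `λ`); conclusion `LocalGaugeSplitOn Y η_{K−n} t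
  (t₁ + (t₂ + t_∂) + t₃) U` for EVERY `t_∂ > 2CB₃(s + s)`; ★★ `localGaugeSplitOn_of_gauge152_coarseShift_levLift_under_adm22_T4` (THE SHARP DOOR: `hsout` + `hunder` = the size
  at the outer end-points and at the fine sites under them — nothing asked far from the datum's boundary cells); ★ `localGaugeSplitOn_of_gauge152_coarseShift_ofSize_adm22_T4`
  (the global-size door `∀ j y, ‖λ_j(y)‖ ≤ s`).
* §3 (AT THE RECORD: `avOfRecord F N K`, `SU(N) ⊂ M_N(ℂ)`) ★ `norm_mlog_centredShear_inv_le_box_record` (the (r1) shift letter's size `‖log ĝ_j(y)⁻¹‖ ≤ 2·D_j·(v + a)` on the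
  level-`j` box once `D_j·(v + a) ≤ ½` — twin of dag-n07-w6's `norm_mlog_centredShear_le_box_record` for the inverse, `‖U⋆ − 1‖ = ‖U − 1‖`); ★★★
  `localGaugeSplitOn_of_gauge152_recordShear_adm22_T4 F N` (§2's sharp door at `λ_j(y) := log ĝ_j(y)⁻¹` with per-level boxes `[lo_j, hi_j]`, per-level box bond letters `v_j`
  (data `M^j(U₁^{u♮})`) and `a_j` (the Landau copy's averages `M^j(U₁)`) as in dag-n07-w6 §3, a uniform `σ` with `D_j·(v_j + a_j) ≤ σ ≤ ½` at the levels `j ≤ K − n`; GEOMETRY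
  DISPLAYED: outer end-points in the level-`j` box, `Λ_j`-sites in the level-`j` box for `j ≥ 1`, fine `Λ₀`-sites under outer end-points in the level-`0` box; conclusion: the clause
  for EVERY `t_∂ > 2CB₃·(4σ)`).
HONEST SCOPE.  Count-neutral ∃-packaging ∕ by-name composition of landed theorems (FILE 5 p621432, FILE 6 p622998, dag-n07-w6 p615982, dag-n07-e p611058) plus one convexity
lemma; DISPLAYED, not discharged: the box letters `v_j` ((151) ∕ module 40 ∕ (155)) and `a_j` ((152) ∕ dag-n07-w2's weighted-ball bound), the Landau copy `u♮, U₁` of the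
(r1)+(r4) row (its identification with S3's gauge of `U` on the window is the head's), S3's gauge and (152) letters, the (159)-splitting `A − H_V X = A₁ + A₂ − A₃` and its three
letters, P12's tower ∕ window hypotheses, the box-membership of the tower's boundary cells.  Nothing of [15]∕[6]∕[4]∕[3] ANALYSIS asserted; `LocalLettersSplitTopStepCore` ∕
`DatumGaugeSplitTopStepCore` ∕ `HalvingStepTop(Core)` ∕ `stub_prop8StepCoP13` NOT discharged; K0⁷ ∕ K1⁹ NOT closed; N07 NOT discharged; counts unmoved (typed 28∕28 · discharged
5∕27); one finite 𝕋⁴ programme at fixed ε — the route closes the conditional finite-𝕋⁴ rung `BalabanLadder.UV` ONLY; the YM mass gap (Clay) is NOT proved by any of this; nothing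
continuum ∕ ℝ⁴ ∕ OS.  No `sorry`, no `def`, no `instance`, no `notation`.

RELATED IN THE TREE, NOT DUPLICATED (stem check 2026-08-28T10:08Z: `ls …/Theorems | rg -i 'SplitClauseOfShear|OfShearSize'` = ∅; `rg 'levLift_adm22|recordShear_adm22|
centredShear_inv|forall_under_le|norm_le_under'` over lean∕ = ∅): FILE 6 `N07SplitClauseOfCoarseShift` (§2 with `μ`, `hμ`, `hout` DISPLAYED — CONSUMED, the three SUPPLIED here;
its §1c `norm_siteAvgIter_le_of_forall_le` is the GLOBAL convexity bound — §1 below is its block-local edition); FILE 5 `N07CoarseGaugeQForm` (`siteAvgIter_levLift` — CONSUMED);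
dag-n07-w6 `N07ShearSizeTopBox` (§3 `dist1_centredShear_le_box_record`, §4 the composed row whose shift letter §3 below sizes — CONSUMED, not restated); dag-n07-e
`Node00/ShearedDatumCentred` (the centred shear — through dag-n07-w6); ym3-torus `FlatCubeLevels` (`lamSite_levOf_inOm` — CONSUMED); lit-balaban `B5Eq118OneStroke`
(`siteAvgIter_eq_blockSum`, `card_iterBlock`, `mem_iterBlock` — CONSUMED).

References: [15] (144) p. 300, (150)–(152) p. 301, (157)–(159) pp. 302–303, (161) p. 303, (164)–(165) p. 304, (168) p. 304; [6] (1.2) p. 76, (1.54) p. 85, (1.131) p. 99; [4]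
(2.1)–(2.4) p. 224, (2.35) p. 228, (2.60) p. 234, Cor. 2.8 (2.150)–(2.151) p. 249; [I.4] (1.13) p. 19, (1.18)–(1.20) p. 20; [3] (11) p. 19, (21) p. 21, (85)–(88) p. 31.
-/

set_option autoImplicit false

noncomputable section
open scoped BigOperators Matrix.Norms.L2Operator

namespace Summit.QuantumFields.YangMills.BalabanUVNodes.N07SplitClauseOfShearSize

open Literature.MathematicalPhysics.QuantumFieldTheory.Balaban1983to89
open Literature.MathematicalPhysics.QuantumFieldTheory.Balaban1983to89.Node00
open Literature.MathematicalPhysics.QuantumFieldTheory.Balaban1983to89.B12RegularSpaces111 (gaugeU expI grad)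
open LatticeFieldCalculus (siteAvgIter bondAvgIter)
open B5Eq118OneStroke (iterBlockOf iterBlock mem_iterBlock card_iterBlock siteAvgIter_eq_blockSum)
open B11Eq115Space (levOf)
open B6SectADomainsV1 (Domains)
open B6SectAOperatorsV1 (BondIdx)
open T4Continuum (T4Family)
open T4AxialGaugeSmallField (castSite)
open B16Sect1Backgrounds (toMS)
open GaugeField (gaugeAct)
open MatrixLog (mlog norm_mlog_le_two_mul)
open Summit.QuantumFields.YangMills.Theorems.FlatCubeLevels (lamSite_levOf_inOm)
open Summit.QuantumFields.YangMills.Theorems.FlatCubeOpsText (Adm22)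
open Summit.QuantumFields.YangMills.Theorems.K0FlatCubeOpsTextP (flatH IsLevWeight)
open Summit.QuantumFields.YangMills.BalabanUVNodes.N07HalvingStepTopOfLocalLetters (Letters10On)
open Summit.QuantumFields.YangMills.BalabanUVNodes.N07LocalLettersSplitCore (LocalGaugeSplitOn)
open Summit.QuantumFields.YangMills.BalabanUVNodes.N07CoarseGaugeQForm (siteAvgIter_levLift)
open Summit.QuantumFields.YangMills.BalabanUVNodes.N07SplitClauseOfCoarseShift (outerDefect_levLift_le_of_norm_le
  localGaugeSplitOn_of_gauge152_coarseShift_outerDefect_adm22_T4)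
open Summit.QuantumFields.YangMills.BalabanUVNodes.N07ShearSizeTopBox (dist1_centredShear_le_box_record)

variable {P : Params} {N : ℕ}

/-! ## §1  The outer defect of the level lift from sizes at and under the outer end-points, generic carrier -/

section Generic

variable {W : Type*} [NormedAddCommGroup W] [NormedSpace ℝ W]

/-- **THE OUTER DEFECT OF THE LEVEL LIFT FROM A GLOBAL SIZE**: if `‖λ_j(y)‖ ≤ s` for every level `j` and every site `y` of `T^{(j)}`, then at every outer end-point
`y_out ∉ Ω_j^{(j)}` of a `Λ_j`-cell `‖λ_j(y_out) − (Q′_jμ_λ)(y_out)‖ ≤ s + s` (FILE 6 `outerDefect_levLift_le_of_norm_le`, whose two size binders a global size trivially meets).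
[cite: Balaban1984PropagatorsII, (2.3)–(2.4) p.224; Balaban1984PropagatorsI, (1.13) p.19, (1.20) p.20] -/
theorem outerDefect_levLift_le_of_forall_norm_le (D : Domains P) (lam : (j : ℕ) → Site P j → W) {s : ℝ}
    (hs : ∀ (j : ℕ) (y : Site P j), ‖lam j y‖ ≤ s) (c : BondIdx D) :
    (c.1.2.src ∉ D.Om c.1.1 → ‖lam c.1.1 c.1.2.src - siteAvgIter (c.1.1 : ℕ) (fun x => lam (levOf (fun i => {z : Site P 0 | D.InOm i z}) D.k x)
        (iterBlockOf (levOf (fun i => {z : Site P 0 | D.InOm i z}) D.k x) x)) c.1.2.src‖ ≤ s + s) ∧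
    (c.1.2.tgt ∉ D.Om c.1.1 → ‖lam c.1.1 c.1.2.tgt - siteAvgIter (c.1.1 : ℕ) (fun x => lam (levOf (fun i => {z : Site P 0 | D.InOm i z}) D.k x)
        (iterBlockOf (levOf (fun i => {z : Site P 0 | D.InOm i z}) D.k x) x)) c.1.2.tgt‖ ≤ s + s) :=
  outerDefect_levLift_le_of_norm_le D lam (fun j y _ => hs j y) (fun _ => ⟨fun _ => hs _ _, fun _ => hs _ _⟩) c

/-- **`Q′_j` IS A CONVEX COMBINATION OVER THE BLOCK — block-local edition** of FILE 6's `norm_siteAvgIter_le_of_forall_le`: `‖(Q′_jf)(y)‖ ≤ a` as soon as `‖f(x)‖ ≤ a` on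
the `L^{jd}` fine sites `x ∈ Bʲ(y)` ALONE ([I.4] (1.20) one-stroke form `siteAvgIter_eq_blockSum`, `|Bʲ(y)| = L^{jd}`). [cite: Balaban1984PropagatorsI, (1.13) p.19, (1.18)–(1.20) p.20] -/
theorem norm_siteAvgIter_le_of_forall_under_le {j : ℕ} (hj : j ≤ P.m + P.K) (f : SiteField P 0 W) {a : ℝ} (y : Site P j)
    (h : ∀ x : Site P 0, iterBlockOf j x = y → ‖f x‖ ≤ a) : ‖siteAvgIter j f y‖ ≤ a := by
  rw [siteAvgIter_eq_blockSum j hj]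
  have hL : (0 : ℝ) < ((P.L : ℝ) ^ P.d) ^ j := pow_pos (pow_pos (Nat.cast_pos.mpr P.L_pos) _) _
  have hsum : ‖∑ x ∈ iterBlock j y, f x‖ ≤ (((P.L ^ P.d) ^ j : ℕ) : ℝ) * a := by
    calc ‖∑ x ∈ iterBlock j y, f x‖ ≤ ∑ x ∈ iterBlock j y, ‖f x‖ := norm_sum_le _ _
      _ ≤ ∑ x ∈ iterBlock j y, a := Finset.sum_le_sum fun x hx => h x ((mem_iterBlock j y x).1 hx)
      _ = (((P.L ^ P.d) ^ j : ℕ) : ℝ) * a := by rw [Finset.sum_const, card_iterBlock j hj y, nsmul_eq_mul]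
  rw [norm_smul, norm_inv, Real.norm_of_nonneg hL.le]
  calc (((P.L : ℝ) ^ P.d) ^ j)⁻¹ * ‖∑ x ∈ iterBlock j y, f x‖
      ≤ (((P.L : ℝ) ^ P.d) ^ j)⁻¹ * ((((P.L ^ P.d) ^ j : ℕ) : ℝ) * a) := mul_le_mul_of_nonneg_left hsum (inv_nonneg.mpr hL.le)
    _ = a := by rw [Nat.cast_pow, Nat.cast_pow, ← mul_assoc, inv_mul_cancel₀ hL.ne', one_mul]

/-- ★ **THE SHARP OUTER DEFECT OF THE LEVEL LIFT**: if `‖λ_j(y_out)‖ ≤ s′` at every outer end-point `y_out ∉ Ω_j^{(j)}` of a `Λ_j`-cell and `‖μ_λ(x)‖ ≤ s` at every fine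
site `x ∈ Bʲ(y_out)` UNDER such an end-point (`μ_λ(x) = λ_{j(x)}(B^{j(x)}x)`, FILE 5's level lift), then `‖λ_j(y_out) − (Q′_jμ_λ)(y_out)‖ ≤ s′ + s` — nothing is asked at
`Λ`-sites away from the boundary cells ([4] (2.3): the outer end-point is bond-adjacent to `Ω_j^{(j)}`). [cite: Balaban1984PropagatorsII, (2.3)–(2.4) p.224; Balaban1984PropagatorsI, (1.13) p.19, (1.18)–(1.20) p.20] -/
theorem outerDefect_levLift_le_of_norm_le_under (D : Domains P) (lam : (j : ℕ) → Site P j → W) {s s' : ℝ}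
    (hsout : ∀ c : BondIdx D, (c.1.2.src ∉ D.Om c.1.1 → ‖lam c.1.1 c.1.2.src‖ ≤ s') ∧ (c.1.2.tgt ∉ D.Om c.1.1 → ‖lam c.1.1 c.1.2.tgt‖ ≤ s'))
    (hunder : ∀ (c : BondIdx D) (x : Site P 0),
      (c.1.2.src ∉ D.Om c.1.1 ∧ iterBlockOf c.1.1 x = c.1.2.src) ∨ (c.1.2.tgt ∉ D.Om c.1.1 ∧ iterBlockOf c.1.1 x = c.1.2.tgt) →
      ‖lam (levOf (fun i => {z : Site P 0 | D.InOm i z}) D.k x) (iterBlockOf (levOf (fun i => {z : Site P 0 | D.InOm i z}) D.k x) x)‖ ≤ s)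
    (c : BondIdx D) :
    (c.1.2.src ∉ D.Om c.1.1 → ‖lam c.1.1 c.1.2.src - siteAvgIter (c.1.1 : ℕ) (fun x => lam (levOf (fun i => {z : Site P 0 | D.InOm i z}) D.k x)
        (iterBlockOf (levOf (fun i => {z : Site P 0 | D.InOm i z}) D.k x) x)) c.1.2.src‖ ≤ s' + s) ∧
    (c.1.2.tgt ∉ D.Om c.1.1 → ‖lam c.1.1 c.1.2.tgt - siteAvgIter (c.1.1 : ℕ) (fun x => lam (levOf (fun i => {z : Site P 0 | D.InOm i z}) D.k x)
        (iterBlockOf (levOf (fun i => {z : Site P 0 | D.InOm i z}) D.k x) x)) c.1.2.tgt‖ ≤ s' + s) := by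
  have hj : (c.1.1 : ℕ) ≤ P.m + P.K := (D.le_of_lamBond c.2).trans D.hk
  exact ⟨fun h => (norm_sub_le _ _).trans (add_le_add ((hsout c).1 h)
      (norm_siteAvgIter_le_of_forall_under_le hj _ _ fun x hx => hunder c x (Or.inl ⟨h, hx⟩))),
    fun h => (norm_sub_le _ _).trans (add_le_add ((hsout c).2 h)
      (norm_siteAvgIter_le_of_forall_under_le hj _ _ fun x hx => hunder c x (Or.inr ⟨h, hx⟩)))⟩

omit [NormedAddCommGroup W] [NormedSpace ℝ W] in
/-- **PLUMBING FOR THE LEVEL LIFT's SIZE**: if a per-level family of sets `W_j ⊆ T^{(j)}` contains every `Λ_j`-site for `j ≥ 1` and contains the fine site `x` in case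
`x ∈ Λ₀`, then it contains the `Λ_{j(x)}`-site `B^{j(x)}x` over `x` (ym3-torus `lamSite_levOf_inOm`: that site IS a `Λ_{j(x)}`-site) — so a size of `λ` on the `W_j`
bounds `μ_λ(x)`. [cite: Balaban1984PropagatorsII, (2.3)–(2.4) p.224 (bookkeeping)] -/
theorem iterBlockOf_levOf_mem_of_lamSite (D : Domains P) (box : (j : ℕ) → Set (Site P j)) (x : Site P 0)
    (hS : ∀ (j : ℕ), 1 ≤ j → ∀ y : Site P j, D.LamSite j y → y ∈ box j) (h0 : D.LamSite 0 x → x ∈ box 0) :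
    iterBlockOf (levOf (fun i => {z : Site P 0 | D.InOm i z}) D.k x) x ∈ box (levOf (fun i => {z : Site P 0 | D.InOm i z}) D.k x) := by
  have hl := lamSite_levOf_inOm D x
  generalize levOf (fun i => {z : Site P 0 | D.InOm i z}) D.k x = i at hl ⊢
  rcases Nat.eq_zero_or_pos i with rfl | hi
  · exact h0 hl
  · exact hS i hi _ hl

end Generic

/-! ## §2  NODE 00's four-tori: the clause from the family's size alone (`μ := μ_λ`) -/

section T4

open scoped Classical in
/-- ★★ **THE R0′ SPLIT CLAUSE AT NODE 00's OBJECTS FROM THE SHEAR FAMILY's SIZE ALONE** — FILE 6 `localGaugeSplitOn_of_gauge152_coarseShift_outerDefect_adm22_T4` at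
`μ := μ_λ` (FILE 5's level lift: `hμ` by `siteAvgIter_levLift`, `hout` with `ς_∂ := s + s` by `outerDefect_levLift_le_of_norm_le`): there are `M_h⁰, R₀` and `C ≥ 0`,
`δ₀, δ₁, B₃ > 0` such that for every height `1 ≤ K − n`, sizes, every admissible tower `D` (`Adm22`, `D.k = K − n`) with its level weights, every window `Y` of top-level
sites, every componentwise extension `H_V` of `flatH`, every matrix family `λ = (λ_j)_j` with `‖λ_j(y)‖ ≤ s` on the `Λ_j`-SITES and at the OUTER END-POINTS of the
`Λ_j`-cells, the datum `X` its coarse gradient (factor `L^{K−n}∕L^{j(c)}`), S3's gauge `u` of `U` with potential `A` on `Y` and (152) letters `t`, the (159)-splitting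
`A − H_V X = A₁ + A₂ − A₃` with letters `t₁, t₂, t₃`: `LocalGaugeSplitOn Y η_{K−n} t (t₁ + (t₂ + t_∂) + t₃) U` for EVERY `t_∂ > 2CB₃(s + s)`.  No `μ`, no `hμ`, no `hout`,
no `M`, no curl binder on the shift side.
[cite: Balaban1985Variational, (152) p.301, (157)–(159) pp.302–303, (161) p.303, (164)–(165) p.304, (168) p.304; Balaban1984PropagatorsII, (2.3)–(2.4) p.224, (2.35) p.228, (2.60) p.234, Cor. 2.8 (2.150)–(2.151) p.249; Balaban1984PropagatorsI, (1.20) p.20] -/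
theorem localGaugeSplitOn_of_gauge152_coarseShift_levLift_adm22_T4 (F : T4Family) (N : ℕ) [NeZero N] :
    ∃ (Mh₀ R₀ : ℕ) (C δ₀ δ₁ B₃ : ℝ), 0 ≤ C ∧ 0 < δ₀ ∧ 0 < δ₁ ∧ 0 < B₃ ∧
    ∀ (n K : ℕ) (_ : 1 ≤ K - n) (_ : K - n + 1 ≤ F.m + K) {Mh R a' : ℕ} (_ : Mh = F.L ^ a') (_ : Mh₀ ≤ Mh) (_ : R₀ ≤ R) (_ : a' + 3 ≤ F.m + n)
      (D : Domains (F.P K)) (_ : D.k = K - n) (_ : Adm22 D R (F.L * Mh))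
      (w : ℕ → PBond (F.P K) 0 → ℝ) (_ : IsLevWeight (F.P K) (K - n) D w)
      {Y : Set (Site (F.P K) 0)} (_ : ∀ x ∈ Y, D.InOm (K - n) x)
      {HV : (BondIdx D → MatA N) →ₗ[ℂ] (PBond (F.P K) 0 → MatA N)}
      (_ : ∀ (B : BondIdx D → MatA N) (b : PBond (F.P K) 0), HV B b = ∑ c, ((flatH (F.P K) (K - n) D (Pi.single c 1) b : ℝ) : ℂ) • B c)
      (lam : (j : ℕ) → Site (F.P K) j → MatA N) {s : ℝ} (_ : 0 ≤ s)
      (_ : ∀ (j : ℕ) (y : Site (F.P K) j), D.LamSite j y → ‖lam j y‖ ≤ s)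
      (_ : ∀ c : BondIdx D, (c.1.2.src ∉ D.Om c.1.1 → ‖lam c.1.1 c.1.2.src‖ ≤ s) ∧ (c.1.2.tgt ∉ D.Om c.1.1 → ‖lam c.1.1 c.1.2.tgt‖ ≤ s))
      {X : BondIdx D → MatA N}
      (_ : ∀ c : BondIdx D, X c = LatticeFieldCalculus.grad (((F.P K).L : ℝ) ^ (K - n) / ((F.P K).L : ℝ) ^ (c.1.1 : ℕ)) (lam c.1.1) c.1.2)
      {U : GaugeField (F.P K) 0 (SU N)} (u : GaugeTransf (F.P K) 0 (SU N)) {A A₁ A₂ A₃ : PBond (F.P K) 0 → MatA N} {t t₁ t₂ t₃ : ℝ}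
      (_ : ∀ b ∈ (Sect2.regionOfSet (F.P K) Y).bonds,
        gaugeU (fun x => ιSU N (u x)) (fun b' => ιSU N (U b')) b = expI ((F.P K).eta (K - n)) (A b))
      (_ : ∀ b ∈ (Sect2.regionOfSet (F.P K) Y).bonds, ‖A b‖ < t)
      (_ : ∀ q ∈ (Sect2.regionOfSet (F.P K) Y).dpairs, ‖grad ((F.P K).eta (K - n)) q.2.1 (fun y => A ⟨y, q.2.2⟩) q.1‖ < t)
      (_ : ∀ b, A b - HV X b = A₁ b + A₂ b - A₃ b)
      (_ : Letters10On Y ((F.P K).eta (K - n)) t₁ A₁) (_ : Letters10On Y ((F.P K).eta (K - n)) t₂ A₂) (_ : Letters10On Y ((F.P K).eta (K - n)) t₃ A₃)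
      {tD : ℝ} (_ : 2 * C * B₃ * (s + s) < tD),
      LocalGaugeSplitOn Y ((F.P K).eta (K - n)) t (t₁ + (t₂ + tD) + t₃) U := by
  obtain ⟨Mh₀, R₀, C, δ₀, δ₁, B₃, hC, hδ₀, hδ₁, hB₃, hmain⟩ := localGaugeSplitOn_of_gauge152_coarseShift_outerDefect_adm22_T4 F N
  refine ⟨Mh₀, R₀, C, δ₀, δ₁, B₃, hC, hδ₀, hδ₁, hB₃, ?_⟩
  intro n K hk1 hk' Mh R a' hMha hMh hR hsize D hDk hAdm w hw Y hY HV hHV lam s hs0 hs hsout X hX U u A A₁ A₂ A₃ t t₁ t₂ t₃ he hA hdA h159 h₁ h₂ h₃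
    tD htD
  -- `μ := μ_λ`: `hμ` from FILE 5, `hout` (with `ς_∂ := s + s`) from FILE 6 §1c
  exact hmain n K hk1 hk' hMha hMh hR hsize D hDk hAdm w hw hY hHV (fun j y hy => siteAvgIter_levLift D lam hy) (add_nonneg hs0 hs0)
    (outerDefect_levLift_le_of_norm_le D lam hs hsout) hX u he hA hdA h159 h₁ h₂ h₃ htD

open scoped Classical in
/-- ★★ **THE SHARP DOOR** — the same clause when the family is sized ONLY at the outer end-points of the `Λ_j`-cells (`‖λ_j(y_out)‖ ≤ s`) and UNDER them
(`‖μ_λ(x)‖ ≤ s` for the fine `x ∈ Bʲ(y_out)`, `μ_λ(x) = λ_{j(x)}(B^{j(x)}x)`): `hout` with `ς_∂ := s + s` by §1 `outerDefect_levLift_le_of_norm_le_under`.  For the per-cube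
tower of [15] (144) (`Ω₀ = T`, so `Λ₀` = the fine torus off `□₁`) this is the satisfiable form: nothing is asked of the shear far from `□̃`.
[cite: Balaban1985Variational, (144) p.300, (152) p.301, (157)–(159) pp.302–303, (161) p.303, (164)–(165) p.304, (168) p.304; Balaban1984PropagatorsII, (2.1)–(2.4) p.224, (2.35) p.228, (2.60) p.234, Cor. 2.8 (2.150)–(2.151) p.249; Balaban1984PropagatorsI, (1.18)–(1.20) p.20] -/
theorem localGaugeSplitOn_of_gauge152_coarseShift_levLift_under_adm22_T4 (F : T4Family) (N : ℕ) [NeZero N] :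
    ∃ (Mh₀ R₀ : ℕ) (C δ₀ δ₁ B₃ : ℝ), 0 ≤ C ∧ 0 < δ₀ ∧ 0 < δ₁ ∧ 0 < B₃ ∧
    ∀ (n K : ℕ) (_ : 1 ≤ K - n) (_ : K - n + 1 ≤ F.m + K) {Mh R a' : ℕ} (_ : Mh = F.L ^ a') (_ : Mh₀ ≤ Mh) (_ : R₀ ≤ R) (_ : a' + 3 ≤ F.m + n)
      (D : Domains (F.P K)) (_ : D.k = K - n) (_ : Adm22 D R (F.L * Mh))
      (w : ℕ → PBond (F.P K) 0 → ℝ) (_ : IsLevWeight (F.P K) (K - n) D w)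
      {Y : Set (Site (F.P K) 0)} (_ : ∀ x ∈ Y, D.InOm (K - n) x)
      {HV : (BondIdx D → MatA N) →ₗ[ℂ] (PBond (F.P K) 0 → MatA N)}
      (_ : ∀ (B : BondIdx D → MatA N) (b : PBond (F.P K) 0), HV B b = ∑ c, ((flatH (F.P K) (K - n) D (Pi.single c 1) b : ℝ) : ℂ) • B c)
      (lam : (j : ℕ) → Site (F.P K) j → MatA N) {s : ℝ} (_ : 0 ≤ s)
      (_ : ∀ c : BondIdx D, (c.1.2.src ∉ D.Om c.1.1 → ‖lam c.1.1 c.1.2.src‖ ≤ s) ∧ (c.1.2.tgt ∉ D.Om c.1.1 → ‖lam c.1.1 c.1.2.tgt‖ ≤ s))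
      (_ : ∀ (c : BondIdx D) (x : Site (F.P K) 0),
        (c.1.2.src ∉ D.Om c.1.1 ∧ iterBlockOf c.1.1 x = c.1.2.src) ∨ (c.1.2.tgt ∉ D.Om c.1.1 ∧ iterBlockOf c.1.1 x = c.1.2.tgt) →
        ‖lam (levOf (fun i => {z : Site (F.P K) 0 | D.InOm i z}) D.k x) (iterBlockOf (levOf (fun i => {z : Site (F.P K) 0 | D.InOm i z}) D.k x) x)‖ ≤ s)
      {X : BondIdx D → MatA N}
      (_ : ∀ c : BondIdx D, X c = LatticeFieldCalculus.grad (((F.P K).L : ℝ) ^ (K - n) / ((F.P K).L : ℝ) ^ (c.1.1 : ℕ)) (lam c.1.1) c.1.2)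
      {U : GaugeField (F.P K) 0 (SU N)} (u : GaugeTransf (F.P K) 0 (SU N)) {A A₁ A₂ A₃ : PBond (F.P K) 0 → MatA N} {t t₁ t₂ t₃ : ℝ}
      (_ : ∀ b ∈ (Sect2.regionOfSet (F.P K) Y).bonds,
        gaugeU (fun x => ιSU N (u x)) (fun b' => ιSU N (U b')) b = expI ((F.P K).eta (K - n)) (A b))
      (_ : ∀ b ∈ (Sect2.regionOfSet (F.P K) Y).bonds, ‖A b‖ < t)
      (_ : ∀ q ∈ (Sect2.regionOfSet (F.P K) Y).dpairs, ‖grad ((F.P K).eta (K - n)) q.2.1 (fun y => A ⟨y, q.2.2⟩) q.1‖ < t)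
      (_ : ∀ b, A b - HV X b = A₁ b + A₂ b - A₃ b)
      (_ : Letters10On Y ((F.P K).eta (K - n)) t₁ A₁) (_ : Letters10On Y ((F.P K).eta (K - n)) t₂ A₂) (_ : Letters10On Y ((F.P K).eta (K - n)) t₃ A₃)
      {tD : ℝ} (_ : 2 * C * B₃ * (s + s) < tD),
      LocalGaugeSplitOn Y ((F.P K).eta (K - n)) t (t₁ + (t₂ + tD) + t₃) U := by
  obtain ⟨Mh₀, R₀, C, δ₀, δ₁, B₃, hC, hδ₀, hδ₁, hB₃, hmain⟩ := localGaugeSplitOn_of_gauge152_coarseShift_outerDefect_adm22_T4 F N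
  refine ⟨Mh₀, R₀, C, δ₀, δ₁, B₃, hC, hδ₀, hδ₁, hB₃, ?_⟩
  intro n K hk1 hk' Mh R a' hMha hMh hR hsize D hDk hAdm w hw Y hY HV hHV lam s hs0 hsout hunder X hX U u A A₁ A₂ A₃ t t₁ t₂ t₃ he hA hdA h159 h₁ h₂ h₃
    tD htD
  exact hmain n K hk1 hk' hMha hMh hR hsize D hDk hAdm w hw hY hHV (fun j y hy => siteAvgIter_levLift D lam hy) (add_nonneg hs0 hs0)
    (outerDefect_levLift_le_of_norm_le_under D lam hsout hunder) hX u he hA hdA h159 h₁ h₂ h₃ htD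

open scoped Classical in
/-- ★ **THE GLOBAL-SIZE DOOR**: the same clause when the family is bounded everywhere, `‖λ_j(y)‖ ≤ s` for every level `j` and every site `y` of `T^{(j)}` (e.g. a pure
gauge whose logarithms are small on the whole torus) — `hs` and `hsout` are then automatic. [cite: Balaban1985Variational, (152) p.301, (157)–(159) pp.302–303, (164)–(165) p.304, (168) p.304; Balaban1984PropagatorsII, (2.3) p.224, Cor. 2.8 (2.150)–(2.151) p.249; Balaban1984PropagatorsI, (1.20) p.20] -/
theorem localGaugeSplitOn_of_gauge152_coarseShift_ofSize_adm22_T4 (F : T4Family) (N : ℕ) [NeZero N] :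
    ∃ (Mh₀ R₀ : ℕ) (C δ₀ δ₁ B₃ : ℝ), 0 ≤ C ∧ 0 < δ₀ ∧ 0 < δ₁ ∧ 0 < B₃ ∧
    ∀ (n K : ℕ) (_ : 1 ≤ K - n) (_ : K - n + 1 ≤ F.m + K) {Mh R a' : ℕ} (_ : Mh = F.L ^ a') (_ : Mh₀ ≤ Mh) (_ : R₀ ≤ R) (_ : a' + 3 ≤ F.m + n)
      (D : Domains (F.P K)) (_ : D.k = K - n) (_ : Adm22 D R (F.L * Mh))
      (w : ℕ → PBond (F.P K) 0 → ℝ) (_ : IsLevWeight (F.P K) (K - n) D w)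
      {Y : Set (Site (F.P K) 0)} (_ : ∀ x ∈ Y, D.InOm (K - n) x)
      {HV : (BondIdx D → MatA N) →ₗ[ℂ] (PBond (F.P K) 0 → MatA N)}
      (_ : ∀ (B : BondIdx D → MatA N) (b : PBond (F.P K) 0), HV B b = ∑ c, ((flatH (F.P K) (K - n) D (Pi.single c 1) b : ℝ) : ℂ) • B c)
      (lam : (j : ℕ) → Site (F.P K) j → MatA N) {s : ℝ} (_ : 0 ≤ s)
      (_ : ∀ (j : ℕ) (y : Site (F.P K) j), ‖lam j y‖ ≤ s)
      {X : BondIdx D → MatA N}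
      (_ : ∀ c : BondIdx D, X c = LatticeFieldCalculus.grad (((F.P K).L : ℝ) ^ (K - n) / ((F.P K).L : ℝ) ^ (c.1.1 : ℕ)) (lam c.1.1) c.1.2)
      {U : GaugeField (F.P K) 0 (SU N)} (u : GaugeTransf (F.P K) 0 (SU N)) {A A₁ A₂ A₃ : PBond (F.P K) 0 → MatA N} {t t₁ t₂ t₃ : ℝ}
      (_ : ∀ b ∈ (Sect2.regionOfSet (F.P K) Y).bonds,
        gaugeU (fun x => ιSU N (u x)) (fun b' => ιSU N (U b')) b = expI ((F.P K).eta (K - n)) (A b))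
      (_ : ∀ b ∈ (Sect2.regionOfSet (F.P K) Y).bonds, ‖A b‖ < t)
      (_ : ∀ q ∈ (Sect2.regionOfSet (F.P K) Y).dpairs, ‖grad ((F.P K).eta (K - n)) q.2.1 (fun y => A ⟨y, q.2.2⟩) q.1‖ < t)
      (_ : ∀ b, A b - HV X b = A₁ b + A₂ b - A₃ b)
      (_ : Letters10On Y ((F.P K).eta (K - n)) t₁ A₁) (_ : Letters10On Y ((F.P K).eta (K - n)) t₂ A₂) (_ : Letters10On Y ((F.P K).eta (K - n)) t₃ A₃)
      {tD : ℝ} (_ : 2 * C * B₃ * (s + s) < tD),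
      LocalGaugeSplitOn Y ((F.P K).eta (K - n)) t (t₁ + (t₂ + tD) + t₃) U := by
  obtain ⟨Mh₀, R₀, C, δ₀, δ₁, B₃, hC, hδ₀, hδ₁, hB₃, hmain⟩ := localGaugeSplitOn_of_gauge152_coarseShift_levLift_adm22_T4 F N
  refine ⟨Mh₀, R₀, C, δ₀, δ₁, B₃, hC, hδ₀, hδ₁, hB₃, ?_⟩
  intro n K hk1 hk' Mh R a' hMha hMh hR hsize D hDk hAdm w hw Y hY HV hHV lam s hs0 hs X hX U u A A₁ A₂ A₃ t t₁ t₂ t₃ he hA hdA h159 h₁ h₂ h₃ tD htD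
  exact hmain n K hk1 hk' hMha hMh hR hsize D hDk hAdm w hw hY hHV lam hs0 (fun j y _ => hs j y) (fun _ => ⟨fun _ => hs _ _, fun _ => hs _ _⟩)
    hX u he hA hdA h159 h₁ h₂ h₃ htD

end T4

/-! ## §3  At the record: the family `λ_j(y) := log ĝ_j(y)⁻¹` of dag-n07-w6's composed row (r1)+(r4), sized by its per-level box letters -/

section Record

variable (F : T4Family) (N : ℕ) [NeZero N]

/-- ★ **THE (r1) SHIFT LETTER's SIZE AT THE RECORD**: for the averaging of record, torus `K`, level `j ≤ m + K`, any `u♮, U₁`, a box `[lo, hi]` of `T^{(j)}` with corner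
`y₀ = castSite lo` and `D := Σ_κ(hi_κ − lo_κ)`, box bond letters `dist1 M^j(U₁^{u♮})(c) ≤ v` and `dist1 M^j(U₁)(c) ≤ a` with `D·(v + a) ≤ ½`: on the box
`‖log ĝ(y)⁻¹‖ ≤ 2·D·(v + a)`, `ĝ := g(y₀)⁻¹·g`, `g := u♮↾T^{(j)}` — dag-n07-w6's row (r4) `dist1_centredShear_le_box_record`, `‖ĝ⁻¹ − 1‖ = ‖ĝ⋆ − 1‖ = ‖ĝ − 1‖`
(`ExpMeanLog.norm_star_sub_one`) and `MatrixLog.norm_mlog_le_two_mul`; the inverse is the letter the composed row `norm_mlog_iter_avOfRecord_centred_sub_le` displays.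
[cite: Balaban1985Variational, (151)–(152) p.301, (164) p.303; Balaban1985Averaging, (21) p.21, (85)–(88) p.31] -/
theorem norm_mlog_centredShear_inv_le_box_record (K : ℕ) (u : GaugeTransf (F.P K) 0 (SU N)) (U₁ : GaugeField (F.P K) 0 (SU N)) {j : ℕ}
    (hj : j ≤ (F.P K).m + (F.P K).K) {lo hi : Fin (F.P K).d → ℤ} {v a : ℝ} (hv0 : 0 ≤ v) (ha0 : 0 ≤ a)
    (hv : ∀ c : PBond (F.P K) j, c.src ∈ (castSite '' Set.Icc lo hi : Set (Site (F.P K) j)) → c.tgt ∈ (castSite '' Set.Icc lo hi : Set (Site (F.P K) j)) →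
      dist1 (Averaging.iter (avOfRecord F N K) j (gaugeAct u U₁) c) ≤ v)
    (ha : ∀ c : PBond (F.P K) j, c.src ∈ (castSite '' Set.Icc lo hi : Set (Site (F.P K) j)) → c.tgt ∈ (castSite '' Set.Icc lo hi : Set (Site (F.P K) j)) →
      dist1 (Averaging.iter (avOfRecord F N K) j U₁ c) ≤ a)
    (hsmall : ((∑ κ, (hi κ - lo κ).toNat : ℕ) : ℝ) * (v + a) ≤ 1 / 2)
    {y : Site (F.P K) j} (hy : y ∈ (castSite '' Set.Icc lo hi : Set (Site (F.P K) j))) :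
    ‖mlog (((((toMS u j (castSite lo))⁻¹ * toMS u j y)⁻¹ : SU N)) : MatA N)‖ ≤ 2 * (((∑ κ, (hi κ - lo κ).toNat : ℕ) : ℝ) * (v + a)) := by
  have h := dist1_centredShear_le_box_record F N K u U₁ hj hv0 ha0 hv ha hy
  have h' : ‖((((toMS u j (castSite lo))⁻¹ * toMS u j y : SU N)) : MatA N) - 1‖ ≤ ((∑ κ, (hi κ - lo κ).toNat : ℕ) : ℝ) * (v + a) := h
  -- the inverse in `SU(N)` is the adjoint
  have e : (((((toMS u j (castSite lo))⁻¹ * toMS u j y)⁻¹ : SU N)) : MatA N) = star ((((toMS u j (castSite lo))⁻¹ * toMS u j y : SU N)) : MatA N) := by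
    rw [← coe_ιSU, map_inv]
    rfl
  have h'' : ‖star ((((toMS u j (castSite lo))⁻¹ * toMS u j y : SU N)) : MatA N) - 1‖ ≤ ((∑ κ, (hi κ - lo κ).toNat : ℕ) : ℝ) * (v + a) := by
    rw [ExpMeanLog.norm_star_sub_one]; exact h'
  rw [e]
  calc ‖mlog (star ((((toMS u j (castSite lo))⁻¹ * toMS u j y : SU N)) : MatA N))‖
      ≤ 2 * ‖star ((((toMS u j (castSite lo))⁻¹ * toMS u j y : SU N)) : MatA N) - 1‖ := norm_mlog_le_two_mul (h''.trans hsmall)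
    _ ≤ 2 * (((∑ κ, (hi κ - lo κ).toNat : ℕ) : ℝ) * (v + a)) := mul_le_mul_of_nonneg_left h'' (by norm_num)

open scoped Classical in
/-- ★★★ **THE R0′ SPLIT CLAUSE AT THE RECORD's CENTRED SHEAR** — §2's sharp door at the family `λ_j(y) := log ĝ_j(y)⁻¹` (`ĝ_j := g_j(castSite lo_j)⁻¹·g_j`,
`g_j := u♮↾T^{(j)}`) that dag-n07-w6's composed row (r1)+(r4) `norm_mlog_iter_avOfRecord_centred_sub_le` DISPLAYS as the shift of the Landau copy's datum, with `s := 2σ`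
from `norm_mlog_centredShear_inv_le_box_record`: there are `M_h⁰, R₀` and `C ≥ 0`, `δ₀, δ₁, B₃ > 0` such that for every height `1 ≤ K − n`, sizes, every admissible
tower `D` with its level weights, window `Y`, componentwise extension `H_V` of `flatH`; every `u♮, U₁` (the (r1)+(r4) row's Landau copy and its gauge — DISPLAYED, their
identification with S3's gauge of `U` is the head's), per-level boxes `[lo_j, hi_j]` of `T^{(j)}` with PER-LEVEL bond letters `v_j` (data `M^j(U₁^{u♮})`) and `a_j` (averages
`M^j(U₁)`) and a uniform `σ` with `D_j·(v_j + a_j) ≤ σ ≤ ½` at the levels `j ≤ K − n` (`D_j := Σ_κ(hi_{j,κ} − lo_{j,κ})`); GEOMETRY (DISPLAYED — the head's window ∕ collar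
construction): every outer end-point of a `Λ_j`-cell lies in the level-`j` box, every `Λ_j`-site with `j ≥ 1` lies in the level-`j` box, and every fine `Λ₀`-site UNDER an outer
end-point lies in the level-`0` box; every family `λ` equal to the letter family above, the datum `X` its coarse gradient, S3's gauge `u` of `U` with potential `A` on `Y` and
(152) letters `t`, the (159)-splitting `A − H_V X = A₁ + A₂ − A₃` with letters `t₁, t₂, t₃`:
`LocalGaugeSplitOn Y η_{K−n} t (t₁ + (t₂ + t_∂) + t₃) U` for EVERY `t_∂ > 2CB₃·(4σ)` — first order in the shear, as LOCATED-QFORM said.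
[cite: Balaban1985Variational, (144) p.300, (150)–(152) p.301, (157)–(159) pp.302–303, (161) p.303, (164)–(165) p.304, (168) p.304; Balaban1985Averaging, (85)–(88) p.31; Balaban1984PropagatorsII, (2.1)–(2.4) p.224, (2.35) p.228, (2.60) p.234, Cor. 2.8 (2.150)–(2.151) p.249; Balaban1984PropagatorsI, (1.18)–(1.20) p.20] -/
theorem localGaugeSplitOn_of_gauge152_recordShear_adm22_T4 :
    ∃ (Mh₀ R₀ : ℕ) (C δ₀ δ₁ B₃ : ℝ), 0 ≤ C ∧ 0 < δ₀ ∧ 0 < δ₁ ∧ 0 < B₃ ∧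
    ∀ (n K : ℕ) (_ : 1 ≤ K - n) (_ : K - n + 1 ≤ F.m + K) {Mh R a' : ℕ} (_ : Mh = F.L ^ a') (_ : Mh₀ ≤ Mh) (_ : R₀ ≤ R) (_ : a' + 3 ≤ F.m + n)
      (D : Domains (F.P K)) (_ : D.k = K - n) (_ : Adm22 D R (F.L * Mh))
      (w : ℕ → PBond (F.P K) 0 → ℝ) (_ : IsLevWeight (F.P K) (K - n) D w)
      {Y : Set (Site (F.P K) 0)} (_ : ∀ x ∈ Y, D.InOm (K - n) x)
      {HV : (BondIdx D → MatA N) →ₗ[ℂ] (PBond (F.P K) 0 → MatA N)}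
      (_ : ∀ (B : BondIdx D → MatA N) (b : PBond (F.P K) 0), HV B b = ∑ c, ((flatH (F.P K) (K - n) D (Pi.single c 1) b : ℝ) : ℂ) • B c)
      -- the (r1)+(r4) row's Landau copy, its gauge, the per-level boxes and their per-level bond letters
      (uL : GaugeTransf (F.P K) 0 (SU N)) (U₁ : GaugeField (F.P K) 0 (SU N)) (lo hi : ℕ → (Fin (F.P K).d → ℤ)) (v a : ℕ → ℝ) {σ : ℝ}
      (_ : ∀ j, 0 ≤ v j) (_ : ∀ j, 0 ≤ a j) (_ : σ ≤ 1 / 2)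
      (_ : ∀ j ≤ K - n, ((∑ κ, (hi j κ - lo j κ).toNat : ℕ) : ℝ) * (v j + a j) ≤ σ)
      (_ : ∀ j ≤ K - n, ∀ c : PBond (F.P K) j, c.src ∈ (castSite '' Set.Icc (lo j) (hi j) : Set (Site (F.P K) j)) →
        c.tgt ∈ (castSite '' Set.Icc (lo j) (hi j) : Set (Site (F.P K) j)) → dist1 (Averaging.iter (avOfRecord F N K) j (gaugeAct uL U₁) c) ≤ v j)
      (_ : ∀ j ≤ K - n, ∀ c : PBond (F.P K) j, c.src ∈ (castSite '' Set.Icc (lo j) (hi j) : Set (Site (F.P K) j)) →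
        c.tgt ∈ (castSite '' Set.Icc (lo j) (hi j) : Set (Site (F.P K) j)) → dist1 (Averaging.iter (avOfRecord F N K) j U₁ c) ≤ a j)
      -- GEOMETRY (displayed): outer end-points, `Λ_j`-sites (`j ≥ 1`) and fine `Λ₀`-sites under outer end-points lie in the level boxes
      (_ : ∀ c : BondIdx D,
        (c.1.2.src ∉ D.Om c.1.1 → c.1.2.src ∈ (castSite '' Set.Icc (lo c.1.1) (hi c.1.1) : Set (Site (F.P K) c.1.1))) ∧
        (c.1.2.tgt ∉ D.Om c.1.1 → c.1.2.tgt ∈ (castSite '' Set.Icc (lo c.1.1) (hi c.1.1) : Set (Site (F.P K) c.1.1))))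
      (_ : ∀ (j : ℕ), 1 ≤ j → ∀ y : Site (F.P K) j, D.LamSite j y → y ∈ (castSite '' Set.Icc (lo j) (hi j) : Set (Site (F.P K) j)))
      (_ : ∀ (c : BondIdx D) (x : Site (F.P K) 0),
        (c.1.2.src ∉ D.Om c.1.1 ∧ iterBlockOf c.1.1 x = c.1.2.src) ∨ (c.1.2.tgt ∉ D.Om c.1.1 ∧ iterBlockOf c.1.1 x = c.1.2.tgt) →
        D.LamSite 0 x → x ∈ (castSite '' Set.Icc (lo 0) (hi 0) : Set (Site (F.P K) 0)))
      -- the shift family and its datum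
      (lam : (j : ℕ) → Site (F.P K) j → MatA N)
      (_ : ∀ (j : ℕ) (y : Site (F.P K) j), lam j y = mlog (((((toMS uL j (castSite (lo j)))⁻¹ * toMS uL j y)⁻¹ : SU N)) : MatA N))
      {X : BondIdx D → MatA N}
      (_ : ∀ c : BondIdx D, X c = LatticeFieldCalculus.grad (((F.P K).L : ℝ) ^ (K - n) / ((F.P K).L : ℝ) ^ (c.1.1 : ℕ)) (lam c.1.1) c.1.2)
      -- S3's gauge of `U` on the window and the (159)-splitting of `A − H_V X`
      {U : GaugeField (F.P K) 0 (SU N)} (u : GaugeTransf (F.P K) 0 (SU N)) {A A₁ A₂ A₃ : PBond (F.P K) 0 → MatA N} {t t₁ t₂ t₃ : ℝ}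
      (_ : ∀ b ∈ (Sect2.regionOfSet (F.P K) Y).bonds,
        gaugeU (fun x => ιSU N (u x)) (fun b' => ιSU N (U b')) b = expI ((F.P K).eta (K - n)) (A b))
      (_ : ∀ b ∈ (Sect2.regionOfSet (F.P K) Y).bonds, ‖A b‖ < t)
      (_ : ∀ q ∈ (Sect2.regionOfSet (F.P K) Y).dpairs, ‖grad ((F.P K).eta (K - n)) q.2.1 (fun y => A ⟨y, q.2.2⟩) q.1‖ < t)
      (_ : ∀ b, A b - HV X b = A₁ b + A₂ b - A₃ b)
      (_ : Letters10On Y ((F.P K).eta (K - n)) t₁ A₁) (_ : Letters10On Y ((F.P K).eta (K - n)) t₂ A₂) (_ : Letters10On Y ((F.P K).eta (K - n)) t₃ A₃)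
      {tD : ℝ} (_ : 2 * C * B₃ * (4 * σ) < tD),
      LocalGaugeSplitOn Y ((F.P K).eta (K - n)) t (t₁ + (t₂ + tD) + t₃) U := by
  obtain ⟨Mh₀, R₀, C, δ₀, δ₁, B₃, hC, hδ₀, hδ₁, hB₃, hmain⟩ := localGaugeSplitOn_of_gauge152_coarseShift_levLift_under_adm22_T4 F N
  refine ⟨Mh₀, R₀, C, δ₀, δ₁, B₃, hC, hδ₀, hδ₁, hB₃, ?_⟩
  intro n K hk1 hk' Mh R a' hMha hMh hR hsize D hDk hAdm w hw Y hY HV hHV uL U₁ lo hi v a σ hv0 ha0 hσ hDσ hv ha hboxO hboxS hbox0 lam hlam X hX U u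
    A A₁ A₂ A₃ t t₁ t₂ t₃ he hA hdA h159 h₁ h₂ h₃ tD htD
  -- the size of the letter family on the level-`j` box, `j ≤ K − n`
  have hlamS : ∀ (j : ℕ) (_ : j ≤ K - n) (y : Site (F.P K) j), y ∈ (castSite '' Set.Icc (lo j) (hi j) : Set (Site (F.P K) j)) →
      ‖lam j y‖ ≤ 2 * σ := by
    intro j hj y hy
    have hjm : j ≤ (F.P K).m + (F.P K).K := (hj.trans hDk.symm.le).trans D.hk
    have hsmall : ((∑ κ, (hi j κ - lo j κ).toNat : ℕ) : ℝ) * (v j + a j) ≤ 1 / 2 := (hDσ j hj).trans hσ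
    rw [hlam j y]
    exact (norm_mlog_centredShear_inv_le_box_record F N K uL U₁ hjm (hv0 j) (ha0 j) (hv j hj) (ha j hj) hsmall hy).trans
      (mul_le_mul_of_nonneg_left (hDσ j hj) (by norm_num))
  have hσ0 : 0 ≤ σ := (mul_nonneg (Nat.cast_nonneg _) (add_nonneg (hv0 0) (ha0 0))).trans (hDσ 0 (Nat.zero_le _))
  have hs0 : 0 ≤ 2 * σ := by positivity
  -- the sharp door's two size binders from the geometry
  have hsout : ∀ c : BondIdx D, (c.1.2.src ∉ D.Om c.1.1 → ‖lam c.1.1 c.1.2.src‖ ≤ 2 * σ) ∧ (c.1.2.tgt ∉ D.Om c.1.1 → ‖lam c.1.1 c.1.2.tgt‖ ≤ 2 * σ) :=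
    fun c => ⟨fun h => hlamS _ ((D.le_of_lamBond c.2).trans hDk.le) _ ((hboxO c).1 h),
      fun h => hlamS _ ((D.le_of_lamBond c.2).trans hDk.le) _ ((hboxO c).2 h)⟩
  have hunder : ∀ (c : BondIdx D) (x : Site (F.P K) 0),
      (c.1.2.src ∉ D.Om c.1.1 ∧ iterBlockOf c.1.1 x = c.1.2.src) ∨ (c.1.2.tgt ∉ D.Om c.1.1 ∧ iterBlockOf c.1.1 x = c.1.2.tgt) →
      ‖lam (levOf (fun i => {z : Site (F.P K) 0 | D.InOm i z}) D.k x) (iterBlockOf (levOf (fun i => {z : Site (F.P K) 0 | D.InOm i z}) D.k x) x)‖ ≤ 2 * σ := by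
    intro c x hx
    have hmem := iterBlockOf_levOf_mem_of_lamSite D (fun j => (castSite '' Set.Icc (lo j) (hi j) : Set (Site (F.P K) j))) x hboxS (hbox0 c x hx)
    exact hlamS _ ((D.le_of_lamSite (lamSite_levOf_inOm D x)).trans hDk.le) _ hmem
  have htD' : 2 * C * B₃ * (2 * σ + 2 * σ) < tD := by
    have : 2 * σ + 2 * σ = 4 * σ := by ring
    rw [this]; exact htD
  exact hmain n K hk1 hk' hMha hMh hR hsize D hDk hAdm w hw hY hHV lam hs0 hsout hunder hX u he hA hdA h159 h₁ h₂ h₃ htD'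

end Record

end Summit.QuantumFields.YangMills.BalabanUVNodes.N07SplitClauseOfShearSize

end
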